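import Mathlib.Data.ZMod.Basic
import Literature.LinearAlgebra.Matrix.PermanentBypass
import Literature.LinearAlgebra.Matrix.PermanentEntryExpansion
import HarnessLib

/-!
# From `{-1, 0, 1}`-matrices to `0/1`-matrices modulo `2^q + 1` (Valiant 1979, §4; Papadimitriou 1994, Thm. 18.3)

The last step of Valiant's reduction `#SAT → PERMANENT(0/1)` (*The complexity of computing the
permanent*, TCS 8 (1979), Lemma 3.3 and §4: integer matrix → nonnegative matrix modulo a suitable
number → `0/1` matrix by edge gadgets) in the single-modulus form of Papadimitriou (*Computational
Complexity*, 1994, proof of Thm. 18.3: "`-1 ≡ 2^q (mod 2^q + 1)`", an edge of weight `2^k` is a chain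
of doubling gadgets). The gadget algebra is `PermanentBypass.lean` (`Matrix.multiSlot`,
`Matrix.permanent_multiSlot`: a tournament gadget with `act` active nodes on the slot `(u, v)` adds
`2^{act-1}` to the entry `(u, v)`, all new entries `0/1`). This file packages it as an explicit map on
square matrices:

* `Literature.LinearAlgebra.Matrix.slotMatrix act K` — one gadget per ENTRY `(r, c)` of an `n × n`
  zero matrix, with `act r c ≤ K` active nodes, on the index type `Fin n ⊕ Fin (n·n) × Fin K`
  (slot `s ↔ (r, c)` by `finProdFinEquiv`); `permanent_slotMatrix`: its permanent is that of the
  matrix `(slotWeight (act r c))_{r,c}` (`slotWeight a = 2^{a-1}`, `slotWeight 0 = 0`);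
  `slotMatrix_apply_eq_zero_or_one`;
* `liftAct q z` — the number of active nodes realising the residue of `z ∈ {-1, 0, 1}` modulo
  `2^q + 1` as a power of two: `1 ↦ 1` (weight `2^0`), `-1 ↦ q + 1` (weight `2^q ≡ -1`), else `0`;
* `Literature.LinearAlgebra.Matrix.zeroOneLift G q := slotMatrix (liftAct q ∘ G) (q + 1)` and
  **`permanent_zeroOneLift_modEq`**: for `G` with entries in `{-1, 0, 1}`,
  `per (zeroOneLift G q) ≡ per G (mod 2^q + 1)` (in `ZMod (2^q + 1)`), `zeroOneLift` being a
  `0/1` matrix of size `n + n²(q+1)`;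
* **`toNat_permanent_zeroOneLift_mod`**: if moreover `0 ≤ per G ≤ 2^q` then
  `per G = (per (zeroOneLift G q)).toNat % (2^q + 1)` — the arithmetic by which the oracle machine
  recovers the integer permanent from one `0/1`-permanent (Valiant 1979, §4; Papadimitriou 1994,
  Thm. 18.3).

## References

* L. G. Valiant, *The complexity of computing the permanent*, Theoret. Comput. Sci. 8 (1979)
  189–201, Lemma 3.3, §4 (pp. 196–198).
* C. H. Papadimitriou, *Computational Complexity*, Addison-Wesley 1994, Thm. 18.3 and its proof.
-/

namespace Literature.LinearAlgebra.Matrix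

open _root_.Matrix Equiv Finset

variable {R : Type*} [CommSemiring R] {n : ℕ}

/-! ### One tournament gadget per entry -/

/-- The slots: slot `s ↔ (r, c) = finProdFinEquiv⁻¹ s` sits on the entry `(r, c)` with `act r c`
active nodes. [cite: Valiant1979, Lemma 3.3] -/
def entrySlots (act : Fin n → Fin n → ℕ) (s : Fin (n * n)) : Slot (Fin n) :=
  ⟨(finProdFinEquiv.symm s).1, (finProdFinEquiv.symm s).2,
    act (finProdFinEquiv.symm s).1 (finProdFinEquiv.symm s).2⟩

/-- **One gadget per entry of the zero matrix**: the `0/1` matrix on `Fin n ⊕ Fin (n·n) × Fin K`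
whose slot `(r, c)` carries the transitive tournament on its first `act r c` of `K` private nodes,
entered from row `r`, leaving to column `c` (`Matrix.multiSlot 0 K`). [cite: Valiant1979, Lemma 3.3] -/
def slotMatrix (act : Fin n → Fin n → ℕ) (K : ℕ) :
    Matrix (Fin n ⊕ Fin (n * n) × Fin K) (Fin n ⊕ Fin (n * n) × Fin K) R :=
  multiSlot (0 : Matrix (Fin n) (Fin n) R) K (entrySlots act)

/-- Entries of `slotMatrix` (the definition of `Matrix.multiSlot` on the zero matrix). [cite: Valiant1979, Lemma 3.3] -/
theorem slotMatrix_apply (act : Fin n → Fin n → ℕ) (K : ℕ) (x y : Fin n ⊕ Fin (n * n) × Fin K) :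
    slotMatrix (R := R) act K x y = match x, y with
      | Sum.inl _, Sum.inl _ => 0
      | Sum.inl r, Sum.inr (s, j) =>
          if r = (entrySlots act s).u ∧ (j : ℕ) = 0 ∧ 0 < (entrySlots act s).act then 1 else 0
      | Sum.inr (s, j), Sum.inl c => if c = (entrySlots act s).v ∧ (j : ℕ) < (entrySlots act s).act then 1 else 0
      | Sum.inr (s, j), Sum.inr (s', j') =>
          if s = s' then (if j = j' then 1 else if j < j' ∧ (j' : ℕ) < (entrySlots act s).act then 1 else 0)
          else 0 := by
  rcases x with r | ⟨s, j⟩ <;> rcases y with c | ⟨s', j'⟩ <;> rfl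

/-- `slotMatrix` is a `0/1` matrix. [cite: Valiant1979, Lemma 3.3] -/
theorem slotMatrix_apply_eq_zero_or_one (act : Fin n → Fin n → ℕ) (K : ℕ)
    (x y : Fin n ⊕ Fin (n * n) × Fin K) :
    slotMatrix (R := R) act K x y = 0 ∨ slotMatrix (R := R) act K x y = 1 := by
  rw [slotMatrix_apply]
  rcases x with r | ⟨s, j⟩ <;> rcases y with c | ⟨s', j'⟩ <;> dsimp only
  · simp
  · split_ifs <;> simp
  · split_ifs <;> simp
  · split_ifs <;> simp

/-- The matrix of weights realised by the gadgets: `(slotWeight (act r c))_{r,c}`,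
`slotWeight a = 2^{a-1}` for `a ≥ 1` and `slotWeight 0 = 0`. [cite: Valiant1979, Lemma 3.3] -/
def weightMatrix (act : Fin n → Fin n → ℕ) : Matrix (Fin n) (Fin n) R :=
  of fun r c => slotWeight R (act r c)

/-- The slots add up to the weight matrix: `addSlots 0 (entrySlots act) = weightMatrix act`. [cite: Valiant1979, Lemma 3.3] -/
theorem addSlots_entrySlots (act : Fin n → Fin n → ℕ) :
    addSlots (0 : Matrix (Fin n) (Fin n) R) (entrySlots act) = weightMatrix act := by
  ext r c
  simp only [addSlots, zero_apply, zero_add, weightMatrix, of_apply, entrySlots]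
  rw [← Fintype.sum_equiv finProdFinEquiv.symm.symm
      (fun p : Fin n × Fin n => if r = p.1 ∧ c = p.2 then slotWeight R (act p.1 p.2) else 0) _
      (fun p => by simp), Fintype.sum_prod_type,
    Finset.sum_eq_single_of_mem r (Finset.mem_univ r) (fun r' _ hr' => by simp [Ne.symm hr']),
    Finset.sum_eq_single_of_mem c (Finset.mem_univ c) (fun c' _ hc' => by simp [Ne.symm hc'])]
  simp

/-- **The gadgets realise the weights**: for `act r c ≤ K`,
`per (slotMatrix act K) = per (weightMatrix act)` (`Matrix.permanent_multiSlot`). [cite: Valiant1979, Lemma 3.3] -/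
theorem permanent_slotMatrix (act : Fin n → Fin n → ℕ) {K : ℕ} (hK : ∀ r c, act r c ≤ K) :
    (slotMatrix (R := R) act K).permanent = (weightMatrix act : Matrix (Fin n) (Fin n) R).permanent := by
  rw [slotMatrix, permanent_multiSlot _ K (entrySlots act) (fun s => hK _ _), addSlots_entrySlots]

/-! ### Residues of `{-1, 0, 1}` modulo `2^q + 1` as powers of two -/

/-- The number of active nodes realising `z ∈ {-1, 0, 1}` modulo `2^q + 1`: `1 ↦ 1` (weight
`2^0 = 1`), `-1 ↦ q + 1` (weight `2^q ≡ -1`), anything else `↦ 0` (weight `0`). [cite: Papadimitriou1994, Thm. 18.3 (proof)] -/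
def liftAct (q : ℕ) (z : ℤ) : ℕ :=
  if z = 1 then 1 else if z = -1 then q + 1 else 0

/-- `liftAct q z ≤ q + 1`. [folklore] -/
theorem liftAct_le (q : ℕ) (z : ℤ) : liftAct q z ≤ q + 1 := by
  unfold liftAct; split_ifs <;> omega

/-- The realised weight of `z ∈ {-1, 0, 1}` is congruent to `z` modulo `2^q + 1`. [cite: Papadimitriou1994, Thm. 18.3 (proof)] -/
theorem cast_slotWeight_liftAct (q : ℕ) {z : ℤ} (hz : z = -1 ∨ z = 0 ∨ z = 1) :
    ((slotWeight ℤ (liftAct q z) : ℤ) : ZMod (2 ^ q + 1)) = (z : ZMod (2 ^ q + 1)) := by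
  rcases hz with rfl | rfl | rfl
  · have h1 : liftAct q (-1) = q + 1 := by simp [liftAct]
    rw [h1, slotWeight, if_neg (Nat.succ_ne_zero q), Nat.add_sub_cancel]
    have h0 : ((2 ^ q + 1 : ℕ) : ZMod (2 ^ q + 1)) = 0 := ZMod.natCast_self _
    push_cast at h0 ⊢
    exact eq_neg_of_add_eq_zero_left h0
  · simp [liftAct, slotWeight]
  · simp [liftAct, slotWeight]

/-! ### The `0/1` lift of a `{-1, 0, 1}`-matrix -/

/-- **The `0/1` lift** of an integer matrix `G` modulo `2^q + 1`: one tournament gadget per entry,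
with `liftAct q (G r c)` active nodes out of `q + 1`; a `0/1` matrix of size `n + n²(q+1)` on the
index type `Fin n ⊕ Fin (n·n) × Fin (q+1)`. [cite: Valiant1979, §4] -/
def zeroOneLift (G : Matrix (Fin n) (Fin n) ℤ) (q : ℕ) :
    Matrix (Fin n ⊕ Fin (n * n) × Fin (q + 1)) (Fin n ⊕ Fin (n * n) × Fin (q + 1)) ℤ :=
  slotMatrix (fun r c => liftAct q (G r c)) (q + 1)

/-- The lift is a `0/1` matrix. [cite: Valiant1979, §4] -/
theorem zeroOneLift_apply_eq_zero_or_one (G : Matrix (Fin n) (Fin n) ℤ) (q : ℕ)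
    (x y : Fin n ⊕ Fin (n * n) × Fin (q + 1)) :
    zeroOneLift G q x y = 0 ∨ zeroOneLift G q x y = 1 :=
  slotMatrix_apply_eq_zero_or_one _ _ x y

/-- The permanent of the lift is nonnegative. [folklore] -/
theorem permanent_zeroOneLift_nonneg (G : Matrix (Fin n) (Fin n) ℤ) (q : ℕ) :
    0 ≤ (zeroOneLift G q).permanent :=
  permanent_nonneg_of_nonneg _ fun x y => by
    rcases zeroOneLift_apply_eq_zero_or_one G q x y with h | h <;> simp [h]

/-- The permanent commutes with the entrywise cast from `ℤ`. [folklore] -/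
private theorem permanent_map_intCast {m : Type*} [DecidableEq m] [Fintype m] {T : Type*}
    [CommRing T] (M : Matrix m m ℤ) :
    (M.map (Int.cast : ℤ → T)).permanent = ((M.permanent : ℤ) : T) := by
  simp only [Matrix.permanent, Matrix.map_apply, Int.cast_sum, Int.cast_prod]

/-- **The lift computes the permanent modulo `2^q + 1`**: for a matrix `G` with entries in
`{-1, 0, 1}`, `per (zeroOneLift G q) ≡ per G (mod 2^q + 1)` — the gadgets realise the weight
matrix (`permanent_slotMatrix`), whose entries `0, 1, 2^q` are the residues of `0, 1, -1`, and the
permanent is a polynomial in the entries. (Valiant 1979, §4; Papadimitriou 1994, proof of Thm. 18.3.) [cite: Valiant1979, §4] -/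
theorem permanent_zeroOneLift_modEq (G : Matrix (Fin n) (Fin n) ℤ) (q : ℕ)
    (hG : ∀ r c, G r c = -1 ∨ G r c = 0 ∨ G r c = 1) :
    (((zeroOneLift G q).permanent : ℤ) : ZMod (2 ^ q + 1)) = ((G.permanent : ℤ) : ZMod (2 ^ q + 1)) := by
  rw [zeroOneLift, permanent_slotMatrix _ (fun r c => liftAct_le q (G r c)),
    ← permanent_map_intCast, ← permanent_map_intCast]
  congr 1
  ext r c
  simp only [map_apply, weightMatrix, of_apply]
  exact cast_slotWeight_liftAct q (hG r c)

/-- **Recovering the integer permanent**: if `G` has entries in `{-1, 0, 1}` and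
`0 ≤ per G ≤ 2^q`, then `per G = (per (zeroOneLift G q)).toNat % (2^q + 1)` (as natural numbers;
the left side through `Int.toNat`). [cite: Valiant1979, §4] -/
theorem toNat_permanent_zeroOneLift_mod (G : Matrix (Fin n) (Fin n) ℤ) (q : ℕ)
    (hG : ∀ r c, G r c = -1 ∨ G r c = 0 ∨ G r c = 1) (h0 : 0 ≤ G.permanent)
    (hq : G.permanent ≤ 2 ^ q) :
    (zeroOneLift G q).permanent.toNat % (2 ^ q + 1) = G.permanent.toNat := by
  have hmod := (ZMod.intCast_eq_intCast_iff' _ _ _).1 (permanent_zeroOneLift_modEq G q hG)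
  push_cast at hmod
  have hL := permanent_zeroOneLift_nonneg G q
  have hP : G.permanent % (2 ^ q + 1 : ℤ) = G.permanent := Int.emod_eq_of_lt h0 (Int.lt_add_one_iff.2 hq)
  have key : (((zeroOneLift G q).permanent.toNat % (2 ^ q + 1) : ℕ) : ℤ) = (G.permanent.toNat : ℤ) := by
    push_cast
    rw [Int.toNat_of_nonneg hL, Int.toNat_of_nonneg h0, hmod, hP]
  exact_mod_cast key

end Literature.LinearAlgebra.Matrix
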